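import Mathlib
import HarnessLib
import HarnessLib.Audit
import Summits.PneNP.PneNP.Theses.BorrowedMemory
import Literature.Computability.Complexity.CatalyticSpace
import Literature.Computability.Complexity.CatalyticSpaceLogspace
import Literature.Computability.Complexity.TrivialLanguagesSpace

/-!
# Line `birth` — BC3 skeleton for the crux `NPNotCatalytic` (stmt-PneNP-19091)

Route `BorrowedMemory` (route-PneNP-BorrowedMemory), crux (rank 3) `NPNotCatalytic` = `NP ⊄ CL`:
some language of Cook's class `PNPWave0.NP Bool` is decided by NO catalytic logspace machine
(Buhrman–Cleve–Koucký–Loff–Speelman 2014: `O(log n)` clean space, one polynomial-length auxiliary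
tape handed over FULL with an arbitrary content `τ` and returned bit for bit; the route types the
class inline over the tree's `SpaceMachine`s, and `Literature.Computability.Complexity.InCL`
(`CatalyticSpace.lean`) is that inline `let InCL` VERBATIM, so the crux is
`∃ L ∈ PNPWave0.NP Bool, ¬ InCL L` by `Iff.rfl`, cf. `npNotCatalytic_iff` below).

THE LINE = THE ROUTE'S OWN FORESEEN SPLIT OF X₂ (route header, TWO-LAYER PLAN: "NPNotCatalytic ⇐
SatNotCLP → SatCatalyticIsPolytime → NPNotCatalytic"), in the WITNESS-FREE form of rev 1 (no `SAT`,
no Cook–Levin, so the import cone stays `Space`/`CatalyticSpace`, conjecture-free): cut the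
time-unbounded class `CL` at its POLYNOMIAL-TIME section `CLP` (catalytic logspace with a
simultaneous polynomial bound on the number of steps, for every initial content `τ`; BCKLS 2014 §8 /
Koucký 2016 / Mertz 2023: `CL ⊆ ZPP` because for all but a negligible fraction of the contents `τ`
the run is polynomial, and "whether CL = CLP", i.e. whether the bad contents can be avoided
deterministically, is open — it would give `CL ⊆ P`, open in both directions as of
arXiv:2504.17412, p. 2). Two named pieces and a short real seam:

* `stub_npNotCatalyticPolytime` — `NP ⊄ CLP`: some language of `PNPWave0.NP Bool` has no catalytic
  logspace decider that halts within `q(|x|)` steps on every input `x` and every content `τ`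
  (`InCLP` = the inline `InCL` with one more polynomial `q` and the halting clause
  `cfg ∈ eval` replaced by `EvalsToInTime … (some cfg) (q(|x|)) ∧ step cfg = none`, exactly the
  convention of `SpaceMachine.HaltsWithIn` / `DTISP`). In print `CLP ⊆ P` (run the machine on the
  all-zero content), so this piece is a CONSEQUENCE of the summit — a simultaneous time/catalytic-
  space lower bound for NP, the regime of time–space trade-offs (Fortnow–van Melkebeek, Williams)
  but with polynomial FULL memory and the restoration promise as the extra handle; it is also a
  consequence of the crux (`stub_npNotCatalyticPolytime_of_crux`, proved: `CLP ⊆ CL`). At least as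
  hard as `L ≠ NP` (`LOGSPACE ⊆ CLP`).
* `stub_npCatalyticSpeedup` — `NP ∩ CL ⊆ CLP`: every language of `PNPWave0.NP Bool` that HAS a
  catalytic logspace decider has one that moreover runs in polynomial time for every content. The
  NP-instance of the open `CL = CLP` question (BCKLS 2014 §8; compress-or-compute gives polynomial
  time on average over `τ`, BCKLS Thm. 19, and the structure theory of Cook–Li–Mertz–Pyne 2025 /
  Koucký–Mertz–Pyne–Sami 2025 is the toolbox); consistent with `P = NP` and with `P ≠ NP`, so it is
  neither the crux nor the summit in disguise, and it has content exactly on `NP ∩ CL ∋` matching,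
  `TC¹`-languages, … (for the witness of Stub 1 it is used contrapositively).
* the SEAM (sorry-free, proved here): `npNotCatalytic_of_sigs` — take the NP language `L ∉ CLP` of
  Stub 1; were `L ∈ CL`, Stub 2 would put it in `CLP`. Its conclusion is the crux's body verbatim,
  so that `NPNotCatalytic_of` is the file's ONLY theorem whose head is the crux name (what
  `ledger skeleton check` keys on).
* `NPNotCatalytic_of : NPNotCatalytic` — THE skeleton theorem: the crux BY NAME from the two
  declared stubs (the only `sorry`s of the file).
* proved extras: `inCL_of_inCLP` (`CLP ⊆ CL` pointwise: a run that halts within `q(|x|)` steps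
  halts), `stub_npNotCatalyticPolytime_of_crux` (crux ⇒ Stub 1: the BC2-converse, recorded),
  `npNotCatalytic_iff` (the crux is `∃ L ∈ NP, ¬ InCL L` over `CatalyticSpace.lean`, `Iff.rfl`), and
  NON-VACUITY of the time-bounded class: `inCLP_univ`, `inCLP_empty` (`univ, ∅ ∈ CLP`, by the
  constant-answer machine of `TrivialLanguagesSpace.lean` with the two idle catalytic stacks of
  `CatalyticSpaceLogspace.lean`, clean constant `1`, catalytic polynomial `X`, TIME BOUND `1`).

Disproof used: none exists for this crux (`ledger crux ls stmt-PneNP-19091`: no workfiles, no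
Disproof.lean, no crux ideas, 2026-08-17). Evidence honoured: the refuter's birth attack
(Sanity.lean, rc0: `InCL ∅`, `InCL univ`, all four clauses of `InCL` load-bearing) — `InCLP` keeps
every clause of `InCL` verbatim and only ADDS the step bound, and the same one-step machines inhabit
it (`inCLP_univ`, `inCLP_empty`, proved below; `LOGSPACE ⊆ CLP` would need a configuration count and
is not needed by the skeleton). Negatives: `ledger negatives --problem PneNP` has no space-bounded statement. Typing
checklist 4c: no thresholds (all constants `∃`-bound: `c`, `p`, `q`), no integrals, no gauge.
BC3 probes (seat folder `bc/probe_*.lean`): `stub → NPNotCatalytic` and `stub → PneNP` by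
`first | exact? | simpa | aesop` FAIL for both stubs (outputs in the seat's NOTES.md and in
`Lines/birth.md`). Planner planner-skel-stmt-PneNP-19091-0, 2026-08-17.
-/

set_option linter.dupNamespace false
set_option linter.unusedVariables false

noncomputable section

namespace Summit.PneNP.PneNP.Cruxes.NPNotCatalytic.Birth

open Literature.Computability.Complexity
open Summit.PneNP.PneNP.Theses.BorrowedMemory

/-! ## The time-bounded class, for reference (the stubs inline it verbatim) -/

/-- **Polynomial-time catalytic logspace decidability** `InCLP L` (`L ∈ CLP`): the inline `InCL` of
the route (= `Literature.Computability.Complexity.InCL`, BCKLS 2014) with ONE MORE polynomial `q` and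
the halting clause strengthened from `cfg ∈ eval step start` to "reached from `start` within
`q(|x|)` steps and halting" (`Nonempty (EvalsToInTime step start (some cfg) (q(|x|))) ∧ step cfg =
none`, the convention of `SpaceMachine.HaltsWithIn`), for every input `x` AND EVERY content `τ`.
Documentation only: the registered stubs below carry this body as a `let`, verbatim.
[cite: BuhrmanEtAl2014, §8 (is CL ⊆ P? polynomial time for every initial content)] -/
def InCLP (L : Language Bool) : Prop :=
  ∃ (M : Literature.Computability.Complexity.SpaceMachine Bool Bool) (kA kB : M.tm.K) (eA : M.tm.Γ kA ≃ Bool) (_eB : M.tm.Γ kB ≃ Bool) (c : ℕ) (p q : Polynomial ℕ), kA ≠ M.tm.k₀ ∧ kA ≠ M.tm.k₁ ∧ kA ≠ M.kL ∧ kB ≠ M.tm.k₀ ∧ kB ≠ M.tm.k₁ ∧ kB ≠ M.kL ∧ kA ≠ kB ∧ ∀ (x : List Bool) (τ : List Bool), τ.length = p.eval x.length → haveI := M.tm.kDecidableEq; haveI := M.tm.kFin; let start : M.tm.Cfg := ⟨(M.init x).l, (M.init x).var, Function.update (M.init x).stk kA (τ.map eA.symm)⟩; (∀ cfg : M.tm.Cfg,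 StateTransition.Reaches M.tm.step start cfg → ((cfg.stk M.kL).map M.leftAlphabet).reverse ++ (cfg.stk M.tm.k₀).map M.inputAlphabet = x ∧ (∑ k ∈ (((Finset.univ.erase M.tm.k₀).erase M.kL).erase kA).erase kB, (cfg.stk k).length) ≤ c * Nat.log 2 x.length + c ∧ (cfg.stk kA).length + (cfg.stk kB).length ≤ p.eval x.length + c) ∧ (∃ cfg : M.tm.Cfg, (Nonempty (StateTransition.EvalsToInTime M.tm.step start (some cfg) (q.eval x.length)) ∧ M.tm.step cfg = none) ∧ (x ∈ L → (cfg.stk M.tm.k₁).map M.outputAlphabet = [true]) ∧ (x ∉ L → (cfg.stk M.tm.k₁).map M.outputAlphabet = [false]) ∧ cfg.stk kA = τ.map eA.symm ∧ cfg.stk kB = [])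

/-! ## The two registered stubs -/

/-- **Stub 1 (`NP ⊄ CLP`: an NP language outside POLYNOMIAL-TIME catalytic logspace; open, size XL —
the route's foreseen `SatNotCLP`, witness-free).** Some `L ∈ PNPWave0.NP Bool` is decided by no
input-preserving `SpaceMachine` with two extra binary stacks `kA`, `kB` (content `τ`, `|τ| = p(|x|)`,
restored at the halt), clean space `≤ c·log₂|x| + c`, catalytic length `≤ p(|x|) + c`, halting within
`q(|x|)` steps for EVERY `x` and EVERY `τ`. In print `CLP ⊆ P` (all-zero content), so this follows
from `P ≠ NP`; it also follows from the crux (`CLP ⊆ CL`, `stub_npNotCatalyticPolytime_of_crux`); it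
implies `NP ⊄ LOGSPACE`. The handle a proof must use: the time bound together with exact restoration
for all `2^{p(n)}` contents (Potechin 2017: without a time bound, nonuniform catalytic programs of
amortised linear size compute everything). [cite: BuhrmanEtAl2014, §8 (CL versus P; polynomial time
for every initial content)] [cite: KouckyEtAl2025, Def. 1–4] -/
theorem stub_npNotCatalyticPolytime :
    let InCLP : Language Bool → Prop := fun L => ∃ (M : Literature.Computability.Complexity.SpaceMachine Bool Bool) (kA kB : M.tm.K) (eA : M.tm.Γ kA ≃ Bool) (_eB : M.tm.Γ kB ≃ Bool) (c : ℕ) (p q : Polynomial ℕ), kA ≠ M.tm.k₀ ∧ kA ≠ M.tm.k₁ ∧ kA ≠ M.kL ∧ kB ≠ M.tm.k₀ ∧ kB ≠ M.tm.k₁ ∧ kB ≠ M.kL ∧ kA ≠ kB ∧ ∀ (x : List Bool) (τ : List Bool), τ.length = p.eval x.length → haveI := M.tm.kDecidableEq; haveI := M.tm.kFin; let start : M.tm.Cfg := ⟨(M.init x).l, (M.init x).var, Function.update (M.init x).stk kA (τ.map eA.symm)⟩; (∀ cfg : M.tm.Cfg, StateTransition.Reaches M.tm.step start cfg → ((cfg.stk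 M.kL).map M.leftAlphabet).reverse ++ (cfg.stk M.tm.k₀).map M.inputAlphabet = x ∧ (∑ k ∈ (((Finset.univ.erase M.tm.k₀).erase M.kL).erase kA).erase kB, (cfg.stk k).length) ≤ c * Nat.log 2 x.length + c ∧ (cfg.stk kA).length + (cfg.stk kB).length ≤ p.eval x.length + c) ∧ (∃ cfg : M.tm.Cfg, (Nonempty (StateTransition.EvalsToInTime M.tm.step start (some cfg) (q.eval x.length)) ∧ M.tm.step cfg = none) ∧ (x ∈ L → (cfg.stk M.tm.k₁).map M.outputAlphabet = [true]) ∧ (x ∉ L → (cfg.stk M.tm.k₁).map M.outputAlphabet = [false]) ∧ cfg.stk kA = τ.map eA.symm ∧ cfg.stk kB = []); ∃ L : Language Bool, L ∈ Literature.Computability.Complexity.PNPWave0.NP Bool ∧ ¬ InCLP L := by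
  sorry

/-- **Stub 2 (`NP ∩ CL ⊆ CLP`: catalytic deciders of NP languages can be made polynomial-time; open,
size XL — the route's foreseen `SatCatalyticIsPolytime`, witness-free).** Every `L ∈ PNPWave0.NP Bool`
with `InCL L` (a catalytic logspace decider, no time bound) has a catalytic logspace decider that in
addition halts within `q(|x|)` steps for every input `x` and EVERY content `τ`. The NP-instance of the
open problem `CL = CLP` (BCKLS 2014 §8; BCKLS Thm. 19 gives polynomial time for all but a negligible
fraction of the contents — compress-or-compute — and `CL ⊆ ZPP`; Cook–Li–Mertz–Pyne 2025 and
Koucký–Mertz–Pyne–Sami 2025 supply the compression/structure toolbox). Consistent with `P = NP` and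
with `P ≠ NP`; NOT implied by `CL ⊆ P` (a `P`-machine is not a `CLP`-machine: `P ⊆ CLP` is the timed
form of the route's other crux). [cite: BuhrmanEtAl2014, Thm. 19 (CSPACE(S) ⊆ ZTIME(2^{O(S)}): polynomial time for most contents) and §8] [cite: KouckyEtAl2025, §1] -/
theorem stub_npCatalyticSpeedup :
    let InCLP : Language Bool → Prop := fun L => ∃ (M : Literature.Computability.Complexity.SpaceMachine Bool Bool) (kA kB : M.tm.K) (eA : M.tm.Γ kA ≃ Bool) (_eB : M.tm.Γ kB ≃ Bool) (c : ℕ) (p q : Polynomial ℕ), kA ≠ M.tm.k₀ ∧ kA ≠ M.tm.k₁ ∧ kA ≠ M.kL ∧ kB ≠ M.tm.k₀ ∧ kB ≠ M.tm.k₁ ∧ kB ≠ M.kL ∧ kA ≠ kB ∧ ∀ (x : List Bool) (τ : List Bool), τ.length = p.eval x.length → haveI := M.tm.kDecidableEq; haveI := M.tm.kFin; let start : M.tm.Cfg := ⟨(M.init x).l, (M.init x).var, Function.update (M.init x).stk kA (τ.map eA.symm)⟩; (∀ cfg : M.tm.Cfg, StateTransition.Reaches M.tm.step start cfg → ((cfg.stk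 M.kL).map M.leftAlphabet).reverse ++ (cfg.stk M.tm.k₀).map M.inputAlphabet = x ∧ (∑ k ∈ (((Finset.univ.erase M.tm.k₀).erase M.kL).erase kA).erase kB, (cfg.stk k).length) ≤ c * Nat.log 2 x.length + c ∧ (cfg.stk kA).length + (cfg.stk kB).length ≤ p.eval x.length + c) ∧ (∃ cfg : M.tm.Cfg, (Nonempty (StateTransition.EvalsToInTime M.tm.step start (some cfg) (q.eval x.length)) ∧ M.tm.step cfg = none) ∧ (x ∈ L → (cfg.stk M.tm.k₁).map M.outputAlphabet = [true]) ∧ (x ∉ L → (cfg.stk M.tm.k₁).map M.outputAlphabet = [false]) ∧ cfg.stk kA = τ.map eA.symm ∧ cfg.stk kB = []); ∀ L : Language Bool, L ∈ Literature.Computability.Complexity.PNPWave0.NP Bool → Literature.Computability.Complexity.InCL L → InCLP L := by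
  sorry

/-! ## Proved: the registered bodies are `CLP`-membership by name; `CLP ⊆ CL`; crux ⇒ Stub 1 -/

/-- The `let`-body of the stubs is `InCLP` (definitional). [folklore] -/
theorem stub_npNotCatalyticPolytime_iff :
    (let InCLP : Language Bool → Prop := fun L => ∃ (M : Literature.Computability.Complexity.SpaceMachine Bool Bool) (kA kB : M.tm.K) (eA : M.tm.Γ kA ≃ Bool) (_eB : M.tm.Γ kB ≃ Bool) (c : ℕ) (p q : Polynomial ℕ), kA ≠ M.tm.k₀ ∧ kA ≠ M.tm.k₁ ∧ kA ≠ M.kL ∧ kB ≠ M.tm.k₀ ∧ kB ≠ M.tm.k₁ ∧ kB ≠ M.kL ∧ kA ≠ kB ∧ ∀ (x : List Bool) (τ : List Bool), τ.length = p.eval x.length → haveI := M.tm.kDecidableEq; haveI := M.tm.kFin; let start : M.tm.Cfg := ⟨(M.init x).l, (M.init x).var, Function.update (M.init x).stk kA (τ.map eA.symm)⟩; (∀ cfg : M.tm.Cfg, StateTransition.Reaches M.tm.step start cfg → ((cfg.stk M.kL).map M.leftAlphabet).reverse ++ (cfg.stk M.tm.k₀).map M.inputAlphabet = x ∧ (∑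 k ∈ (((Finset.univ.erase M.tm.k₀).erase M.kL).erase kA).erase kB, (cfg.stk k).length) ≤ c * Nat.log 2 x.length + c ∧ (cfg.stk kA).length + (cfg.stk kB).length ≤ p.eval x.length + c) ∧ (∃ cfg : M.tm.Cfg, (Nonempty (StateTransition.EvalsToInTime M.tm.step start (some cfg) (q.eval x.length)) ∧ M.tm.step cfg = none) ∧ (x ∈ L → (cfg.stk M.tm.k₁).map M.outputAlphabet = [true]) ∧ (x ∉ L → (cfg.stk M.tm.k₁).map M.outputAlphabet = [false]) ∧ cfg.stk kA = τ.map eA.symm ∧ cfg.stk kB = []); ∃ L : Language Bool, L ∈ Literature.Computability.Complexity.PNPWave0.NP Bool ∧ ¬ InCLP L) ↔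
      ∃ L : Language Bool, L ∈ PNPWave0.NP Bool ∧ ¬ InCLP L :=
  Iff.rfl

/-- The `let`-body of Stub 2 is `∀ L ∈ NP, InCL L → InCLP L` (definitional). [folklore] -/
theorem stub_npCatalyticSpeedup_iff :
    (let InCLP : Language Bool → Prop := fun L => ∃ (M : Literature.Computability.Complexity.SpaceMachine Bool Bool) (kA kB : M.tm.K) (eA : M.tm.Γ kA ≃ Bool) (_eB : M.tm.Γ kB ≃ Bool) (c : ℕ) (p q : Polynomial ℕ), kA ≠ M.tm.k₀ ∧ kA ≠ M.tm.k₁ ∧ kA ≠ M.kL ∧ kB ≠ M.tm.k₀ ∧ kB ≠ M.tm.k₁ ∧ kB ≠ M.kL ∧ kA ≠ kB ∧ ∀ (x : List Bool) (τ : List Bool), τ.length = p.eval x.length → haveI := M.tm.kDecidableEq; haveI := M.tm.kFin; let start : M.tm.Cfg := ⟨(M.init x).l, (M.init x).var, Function.update (M.init x).stk kA (τ.map eA.symm)⟩; (∀ cfg : M.tm.Cfg, StateTransition.Reaches M.tm.step start cfg → ((cfg.stk M.kL).map M.leftAlphabet).reverse ++ (cfg.stk M.tm.k₀).map M.inputAlphabet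 = x ∧ (∑ k ∈ (((Finset.univ.erase M.tm.k₀).erase M.kL).erase kA).erase kB, (cfg.stk k).length) ≤ c * Nat.log 2 x.length + c ∧ (cfg.stk kA).length + (cfg.stk kB).length ≤ p.eval x.length + c) ∧ (∃ cfg : M.tm.Cfg, (Nonempty (StateTransition.EvalsToInTime M.tm.step start (some cfg) (q.eval x.length)) ∧ M.tm.step cfg = none) ∧ (x ∈ L → (cfg.stk M.tm.k₁).map M.outputAlphabet = [true]) ∧ (x ∉ L → (cfg.stk M.tm.k₁).map M.outputAlphabet = [false]) ∧ cfg.stk kA = τ.map eA.symm ∧ cfg.stk kB = []); ∀ L : Language Bool, L ∈ Literature.Computability.Complexity.PNPWave0.NP Bool → Literature.Computability.Complexity.InCL L → InCLP L) ↔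
      ∀ L : Language Bool, L ∈ PNPWave0.NP Bool → InCL L → InCLP L :=
  Iff.rfl

/-- The crux by name is `∃ L ∈ NP, ¬ InCL L` over `CatalyticSpace.lean` (definitional: `InCL` is the
route's inline `let InCL` verbatim). [folklore] -/
theorem npNotCatalytic_iff :
    NPNotCatalytic ↔ ∃ L : Language Bool, L ∈ PNPWave0.NP Bool ∧ ¬ InCL L :=
  Iff.rfl

/-- **`CLP ⊆ CL`, pointwise**: a catalytic decider that halts within `q(|x|)` steps halts (drop the
clock: `EvalsToInTime` gives `Reaches` by `StateTransition.reaches_of_iterate_flip_bind`, and with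
`step cfg = none` that is `cfg ∈ eval`). [folklore] -/
theorem inCL_of_inCLP {L : Language Bool} (h : InCLP L) : InCL L := by
  obtain ⟨M, kA, kB, eA, eB, c, p, q, h₁, h₂, h₃, h₄, h₅, h₆, h₇, h⟩ := h
  refine ⟨M, kA, kB, eA, eB, c, p, h₁, h₂, h₃, h₄, h₅, h₆, h₇, fun x τ hτ => ?_⟩
  obtain ⟨hinv, cfg, ⟨⟨e⟩, hstop⟩, ht, hf, hA, hB⟩ := h x τ hτ
  refine ⟨hinv, cfg, ?_, ht, hf, hA, hB⟩
  exact StateTransition.mem_eval.2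
    ⟨StateTransition.reaches_of_iterate_flip_bind _ e.steps _ _ e.evals_in_steps, hstop⟩

/-- **The crux implies Stub 1** (`NP ⊄ CL → NP ⊄ CLP`, by `CLP ⊆ CL`): Stub 1 is a consequence of the
crux, used toward it together with Stub 2 (BC2-converse, recorded; the cheap probes in the other
direction fail, seat folder `bc/`). [folklore] -/
theorem stub_npNotCatalyticPolytime_of_crux (h : NPNotCatalytic) :
    ∃ L : Language Bool, L ∈ PNPWave0.NP Bool ∧ ¬ InCLP L := by
  obtain ⟨L, hNP, hCL⟩ := h
  exact ⟨L, hNP, fun hP => hCL (inCL_of_inCLP hP)⟩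

/-! ## Proved: non-vacuity of the time-bounded class (`univ, ∅ ∈ CLP`) -/

section NonVacuity

open _root_.Computability Turing StateTransition Function

/-- The constant-answer space machine (`TrivialLanguagesSpace.lean`) with two idle catalytic stacks
(`CatalyticSpaceLogspace.lean`). [folklore] -/
abbrev constCat (b : Bool) : CatalyticMachine Bool Bool :=
  CatalyticIdle.idle (ConstAnswer.machine b)

/-- Its start configuration on `x`, `τ`: the embedded start configuration of the constant-answer
machine with `τ` on `CA`. [folklore] -/
theorem constCat_catInit (b : Bool) (x τ : List Bool) :
    (constCat b).catInit x τ =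
      CatalyticIdle.cfgM (ConstAnswer.cfg b (some ())  x [] []) (τ.map (constCat b).catAlphabet.symm) [] := by
  rw [CatalyticIdle.catInit_idle, ConstAnswer.init_eq]
  rfl

/-- Its single step. [folklore] -/
theorem constCat_step_start (b : Bool) (x : List Bool) (a : List Bool) :
    (constCat b).tm.step (CatalyticIdle.cfgM (ConstAnswer.cfg b (some ()) x [] []) a []) =
      some (CatalyticIdle.cfgM (ConstAnswer.cfg b none x [b] []) a []) := by
  have h := CatalyticIdle.step_cfgM (ConstAnswer.tm b) (ConstAnswer.cfg b (some ()) x [] []) a []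
  rw [ConstAnswer.step_main] at h
  exact h

/-- It halts after that step. [folklore] -/
theorem constCat_step_halt (b : Bool) (x : List Bool) (a : List Bool) :
    (constCat b).tm.step (CatalyticIdle.cfgM (ConstAnswer.cfg b none x [b] []) a []) = none := by
  have h := CatalyticIdle.step_cfgM (ConstAnswer.tm b) (ConstAnswer.cfg b none x [b] []) a []
  rw [ConstAnswer.step_halt] at h
  exact h

/-- **Non-vacuity of `CLP`** (cf. the refuter's `InCL ∅`, `InCL univ` at the crux's birth): every language with constant indicator `b` is in `InCLP`, witnessed by
the constant-answer machine with two idle catalytic stacks, clean-space constant `1`, catalytic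
polynomial `X` (content of length `|x|`) and TIME BOUND `1` (one step: push the answer, halt; the
content is never touched, so it is restored). [folklore] -/
theorem inCLP_of_boolIndicator_const (b : Bool) {L : Language Bool}
    (hL : ∀ x, L.boolIndicator x = b) : InCLP L := by
  have hdec : DecidesInSpace (ConstAnswer.machine b) L (fun _ => 1) := ConstAnswer.decidesInSpace b hL
  have hcat : CatalyticDecides (constCat b) L (fun _ => 1)
      (fun x => (Polynomial.X : Polynomial ℕ).eval x.length) 0 :=
    CatalyticIdle.catalyticDecides hdec _
  refine ⟨(constCat b).toSpaceMachine, (constCat b).kA, (constCat b).kB, (constCat b).catAlphabet,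
    (constCat b).retAlphabet, 1, Polynomial.X, 1, (constCat b).kA_ne_k₀, (constCat b).kA_ne_k₁,
    (constCat b).kA_ne_kL, (constCat b).kB_ne_k₀, (constCat b).kB_ne_k₁, (constCat b).kB_ne_kL,
    (constCat b).kA_ne_kB, fun x τ hτ => ?_⟩
  obtain ⟨h1, -⟩ := hcat x τ hτ
  refine ⟨fun cfg hc => ?_, ?_⟩
  · obtain ⟨hi, hs, hcs⟩ := h1 cfg hc
    dsimp only at hs hcs
    refine ⟨hi, ?_, ?_⟩
    · change (constCat b).cleanSpace cfg ≤ 1 * Nat.log 2 x.length + 1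
      omega
    · change (constCat b).catSpace cfg ≤ (Polynomial.X : Polynomial ℕ).eval x.length + 1
      omega
  · refine ⟨CatalyticIdle.cfgM (ConstAnswer.cfg b none x [b] []) (τ.map (constCat b).catAlphabet.symm) [],
      ⟨⟨⟨⟨1, ?_⟩, ?_⟩⟩, constCat_step_halt b x _⟩, fun hx => ?_, fun hx => ?_, rfl, rfl⟩
    · rw [Function.iterate_one]
      change (constCat b).tm.step ((constCat b).catInit x τ) = _
      rw [constCat_catInit]
      exact constCat_step_start b x _
    · simp
    · have hb : b = true := by rw [← hL x]; exact (Set.mem_iff_boolIndicator (s := L) x).1 hx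
      subst hb
      rfl
    · have hb : b = false := by rw [← hL x]; exact (Set.notMem_iff_boolIndicator (s := L) x).1 hx
      subst hb
      rfl

/-- `univ ∈ CLP`. [folklore] -/
theorem inCLP_univ : InCLP (Set.univ : Set (List Bool)) :=
  inCLP_of_boolIndicator_const true fun x =>
    (Set.mem_iff_boolIndicator (s := (Set.univ : Set (List Bool))) x).1 (Set.mem_univ x)

/-- `∅ ∈ CLP`. [folklore] -/
theorem inCLP_empty : InCLP (∅ : Set (List Bool)) :=
  inCLP_of_boolIndicator_const false fun x =>
    (Set.notMem_iff_boolIndicator (s := (∅ : Set (List Bool))) x).1 (Set.notMem_empty x)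

end NonVacuity

/-! ## The composition (sorry-free) -/

/-- **Composition with explicit hypotheses** (BC3 shape `lower bound for CLP → speed-up on NP →
crux`; the conclusion is the crux's body verbatim). Take the NP language `L ∉ CLP` of the first
hypothesis; if `L` had a catalytic logspace decider, the second would give it a polynomial-time one.
[folklore] -/
theorem npNotCatalytic_of_sigs
    (h₁ : let InCLP : Language Bool → Prop := fun L => ∃ (M : Literature.Computability.Complexity.SpaceMachine Bool Bool) (kA kB : M.tm.K) (eA : M.tm.Γ kA ≃ Bool) (_eB : M.tm.Γ kB ≃ Bool) (c : ℕ) (p q : Polynomial ℕ), kA ≠ M.tm.k₀ ∧ kA ≠ M.tm.k₁ ∧ kA ≠ M.kL ∧ kB ≠ M.tm.k₀ ∧ kB ≠ M.tm.k₁ ∧ kB ≠ M.kL ∧ kA ≠ kB ∧ ∀ (x : List Bool) (τ : List Bool), τ.length = p.eval x.length → haveI := M.tm.kDecidableEq; haveI := M.tm.kFin; let start : M.tm.Cfg := ⟨(M.init x).l, (M.init x).var, Function.update (M.init x).stk kA (τ.map eA.symm)⟩; (∀ cfg : M.tm.Cfg, StateTransition.Reaches M.tm.step start cfg → ((cfg.stk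 M.kL).map M.leftAlphabet).reverse ++ (cfg.stk M.tm.k₀).map M.inputAlphabet = x ∧ (∑ k ∈ (((Finset.univ.erase M.tm.k₀).erase M.kL).erase kA).erase kB, (cfg.stk k).length) ≤ c * Nat.log 2 x.length + c ∧ (cfg.stk kA).length + (cfg.stk kB).length ≤ p.eval x.length + c) ∧ (∃ cfg : M.tm.Cfg, (Nonempty (StateTransition.EvalsToInTime M.tm.step start (some cfg) (q.eval x.length)) ∧ M.tm.step cfg = none) ∧ (x ∈ L → (cfg.stk M.tm.k₁).map M.outputAlphabet = [true]) ∧ (x ∉ L → (cfg.stk M.tm.k₁).map M.outputAlphabet = [false]) ∧ cfg.stk kA = τ.map eA.symm ∧ cfg.stk kB = []); ∃ L : Language Bool, L ∈ Literature.Computability.Complexity.PNPWave0.NP Bool ∧ ¬ InCLP L)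
    (h₂ : let InCLP : Language Bool → Prop := fun L => ∃ (M : Literature.Computability.Complexity.SpaceMachine Bool Bool) (kA kB : M.tm.K) (eA : M.tm.Γ kA ≃ Bool) (_eB : M.tm.Γ kB ≃ Bool) (c : ℕ) (p q : Polynomial ℕ), kA ≠ M.tm.k₀ ∧ kA ≠ M.tm.k₁ ∧ kA ≠ M.kL ∧ kB ≠ M.tm.k₀ ∧ kB ≠ M.tm.k₁ ∧ kB ≠ M.kL ∧ kA ≠ kB ∧ ∀ (x : List Bool) (τ : List Bool), τ.length = p.eval x.length → haveI := M.tm.kDecidableEq; haveI := M.tm.kFin; let start : M.tm.Cfg := ⟨(M.init x).l, (M.init x).var, Function.update (M.init x).stk kA (τ.map eA.symm)⟩; (∀ cfg : M.tm.Cfg, StateTransition.Reaches M.tm.step start cfg → ((cfg.stk M.kL).map M.leftAlphabet).reverse ++ (cfg.stk M.tm.k₀).map M.inputAlphabet = x ∧ (∑ k ∈ (((Finset.univ.erase M.tm.k₀).erase M.kL).erase kA).erase kB, (cfg.stk k).length) ≤ c * Nat.log 2 x.length + c ∧ (cfg.stk kA).length + (cfg.stk kB).length ≤ p.eval x.length +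 c) ∧ (∃ cfg : M.tm.Cfg, (Nonempty (StateTransition.EvalsToInTime M.tm.step start (some cfg) (q.eval x.length)) ∧ M.tm.step cfg = none) ∧ (x ∈ L → (cfg.stk M.tm.k₁).map M.outputAlphabet = [true]) ∧ (x ∉ L → (cfg.stk M.tm.k₁).map M.outputAlphabet = [false]) ∧ cfg.stk kA = τ.map eA.symm ∧ cfg.stk kB = []); ∀ L : Language Bool, L ∈ Literature.Computability.Complexity.PNPWave0.NP Bool → Literature.Computability.Complexity.InCL L → InCLP L) :
    let InCL : Language Bool → Prop := fun L => ∃ (M : Literature.Computability.Complexity.SpaceMachine Bool Bool) (kA kB : M.tm.K) (eA : M.tm.Γ kA ≃ Bool) (_eB : M.tm.Γ kB ≃ Bool) (c : ℕ) (p : Polynomial ℕ), kA ≠ M.tm.k₀ ∧ kA ≠ M.tm.k₁ ∧ kA ≠ M.kL ∧ kB ≠ M.tm.k₀ ∧ kB ≠ M.tm.k₁ ∧ kB ≠ M.kL ∧ kA ≠ kB ∧ ∀ (x : List Bool) (τ : List Bool), τ.length = p.eval x.length → haveI := M.tm.kDecidableEq; haveI := M.tm.kFin; let start : M.tm.Cfg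 := ⟨(M.init x).l, (M.init x).var, Function.update (M.init x).stk kA (τ.map eA.symm)⟩; (∀ cfg : M.tm.Cfg, StateTransition.Reaches M.tm.step start cfg → ((cfg.stk M.kL).map M.leftAlphabet).reverse ++ (cfg.stk M.tm.k₀).map M.inputAlphabet = x ∧ (∑ k ∈ (((Finset.univ.erase M.tm.k₀).erase M.kL).erase kA).erase kB, (cfg.stk k).length) ≤ c * Nat.log 2 x.length + c ∧ (cfg.stk kA).length + (cfg.stk kB).length ≤ p.eval x.length + c) ∧ (∃ cfg : M.tm.Cfg, cfg ∈ StateTransition.eval M.tm.step start ∧ (x ∈ L → (cfg.stk M.tm.k₁).map M.outputAlphabet = [true]) ∧ (x ∉ L → (cfg.stk M.tm.k₁).map M.outputAlphabet = [false]) ∧ cfg.stk kA = τ.map eA.symm ∧ cfg.stk kB = []); ∃ L : Language Bool, L ∈ Literature.Computability.Complexity.PNPWave0.NP Bool ∧ ¬ InCL L := by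
  intro InCL'
  obtain ⟨L, hNP, hL⟩ := h₁
  exact ⟨L, hNP, fun hCL => hL (h₂ L hNP hCL)⟩

/-- **THE SKELETON THEOREM.** The crux `Summit.PneNP.PneNP.Theses.BorrowedMemory.NPNotCatalytic`,
concluded BY NAME from the two DECLARED stubs `stub_npNotCatalyticPolytime` and
`stub_npCatalyticSpeedup` (the only `sorry`s of the file) through the sorry-free composition
`npNotCatalytic_of_sigs`. [folklore] -/
theorem NPNotCatalytic_of : Summit.PneNP.PneNP.Theses.BorrowedMemory.NPNotCatalytic :=
  npNotCatalytic_of_sigs stub_npNotCatalyticPolytime stub_npCatalyticSpeedup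

end Summit.PneNP.PneNP.Cruxes.NPNotCatalytic.Birth

end
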